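import Mathlib
import HarnessLib
import Summits.SmoothPoincare4.SmoothPoincare4.Theses.CylinderEntropy
import Literature.Geometry.Riemannian.LowEntropyHypersurfacesFour
import Literature.Topology.FourManifolds.ConnectedSumClosure
import Literature.Topology.FourManifolds.HomotopyS4SimplyConnected
import Literature.Topology.FourManifolds.SphereSimplyConnected

/-!
# Sketch (crux-ideate, ideator K2, round 1) — first lemmas of two crux idea cards for
`CylinderEntropy.CylinderRungTwo` (stmt-SmoothPoincare4-7631)

Card `kernel-flattening-finite-singular-epoch`: `zonalKernel_sub_one_le`, `kernelArea_le_windowedArea`.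
Card `exoticness-ledger-euclidean-oracle`: `EuclideanThinPiece`, `ledger_reduction` (proved),
`FlowDecomposition`, `cylinderRungTwo_of_flowDecomposition` (proved).
-/

noncomputable section

namespace Summit.SmoothPoincare4.SmoothPoincare4.Cruxes.CylinderRungTwo.IdeatorK2

open scoped Manifold ContDiff ENNReal
open MeasureTheory Set ContinuousMap

/-- The zonal heat kernel of the unit `S⁴`, slice-normalised, exactly as typed in the crux:
`𝔥(τ, x) = ∑_k e^{-k(k+3)τ} (2k+3)/3 · C_k^{(3/2)}(x)` with the Gegenbauer polynomial written as its
finite sum in powers of `2x` (`x = ⟨z', p'⟩ = cos θ`). -/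
def zonalKernel (τ x : ℝ) : ℝ :=
  ∑' k : ℕ, Real.exp (-((k : ℝ) * ((k : ℝ) + 3)) * τ) * ((2 * (k : ℝ) + 3) / 3) *
    ∑ l ∈ Finset.range (k / 2 + 1), (-1 : ℝ) ^ l *
      (∏ j ∈ Finset.range (k - l), ((3 : ℝ) / 2 + (j : ℝ))) /
        (((l.factorial : ℕ) : ℝ) * (((k - 2 * l).factorial : ℕ) : ℝ)) * (2 * x) ^ (k - 2 * l)

/-- **Kernel flattening (spectral gap `λ₁(S⁴) = 4`).** For `τ ≥ 1` the slice-normalised zonal heat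
kernel is uniformly `6e^{-4τ}`-close to `1` on `[-1, 1]`
(`|C_k^{(3/2)}(x)| ≤ C_k^{(3/2)}(1) = (k+1)(k+2)/2`, so the tail is
`∑_{k ≥ 1} e^{-k(k+3)τ}(2k+3)(k+1)(k+2)/6 ≤ 5.04 e^{-4τ}` for `τ ≥ 1`). -/
theorem zonalKernel_sub_one_le (τ : ℝ) (hτ : 1 ≤ τ) (x : ℝ) (hx : |x| ≤ 1) :
    |zonalKernel τ x - 1| ≤ 6 * Real.exp (-4 * τ) := by
  sorry

/-- **Windowed-area domination** (first lemma of card `kernel-flattening-finite-singular-epoch`):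
for window width `√τ ≥ 1`, every slice-normalised kernel area of a set `A ⊆ N = S⁴×ℝ ⊂ ℝ⁶` (the
crux's `F̂_{p,τ}(A)`, Gaussian factor bounded by `1`) is at most `(1 + 6e^{-4τ}) · μH⁴(A)/μH⁴(S⁴)`.
Combined with Hamilton monotonicity and White's `ε`-regularity this PRICES every singularity at
time `T` by the area of the flow at time `T - τ`. -/
theorem kernelArea_le_windowedArea (p : EuclideanSpace ℝ (Fin 6))
    (hp : ∑ i : Fin 5, p (Fin.castSucc i) ^ 2 = 1) (τ : ℝ) (hτ : 1 ≤ τ)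
    (A : Set (EuclideanSpace ℝ (Fin 6)))
    (hA : A ⊆ {z : EuclideanSpace ℝ (Fin 6) | ∑ i : Fin 5, z (Fin.castSucc i) ^ 2 = 1})
    (hAm : MeasurableSet A) :
    (μH[4] (Metric.sphere (0 : EuclideanSpace ℝ (Fin 5)) 1))⁻¹ *
        ∫⁻ z in A, ENNReal.ofReal
          (zonalKernel τ (∑ i : Fin 5, z (Fin.castSucc i) * p (Fin.castSucc i)) *
            Real.exp (-((z 5 - p 5) ^ 2) / (4 * τ))) ∂μH[4]
      ≤ ENNReal.ofReal (1 + 6 * Real.exp (-4 * τ)) *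
          ((μH[4] (Metric.sphere (0 : EuclideanSpace ℝ (Fin 5)) 1))⁻¹ * μH[4] A) := by
  sorry

/-- **Euclidean-thin piece** (card `exoticness-ledger-euclidean-oracle`): a closed connected smooth
`4`-manifold admitting a smooth embedding into `ℝ⁵` as a hypersurface of Colding–Minicozzi entropy
`≤ λ(S² × ℝ²) = 4/e` — the pieces the vendored Euclidean theorem
`ChodoshMantoulidisSchulze2025_lowEntropy_sphere_four` (b) certifies: round-point deaths, compact
shrinker components, capped cores of neck-ended singularity models, the terminal slice. -/
def EuclideanThinPiece (X : Type) [TopologicalSpace X]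
    [ChartedSpace (EuclideanSpace ℝ (Fin 4)) X] : Prop :=
  ∃ (_ : T2Space X) (_ : SecondCountableTopology X) (_ : CompactSpace X) (_ : ConnectedSpace X)
    (_ : IsManifold (𝓡 4) ∞ X) (ι : X → EuclideanSpace ℝ (Fin 5)),
    Manifold.IsSmoothEmbedding (𝓡 4) (𝓡 5) ∞ ι ∧
      Literature.Geometry.Riemannian.gaussianEntropy 4 (Set.range ι) ≤
        Literature.Geometry.Riemannian.gaussianEntropy 4
          (Literature.Geometry.Riemannian.shrinkingCylinder 4 2)

/-- **Ledger reduction (provable now).** An iterated connected sum of Euclidean-thin pieces that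
is homotopy equivalent to `S⁴` is diffeomorphic to `S⁴`: summands of a simply connected connected
sum are simply connected (tree, Kosinski VI.2), a simply connected Euclidean-thin piece is `S⁴`
(vendored CMS 2025 Cor. 1.5(b), `n = 4`), and `S⁴ # S⁴ ≅ S⁴` (tree). -/
theorem ledger_reduction
    (hCMS : Literature.Geometry.Riemannian.ChodoshMantoulidisSchulze2025_lowEntropy_sphere_four)
    (M : Type) [TopologicalSpace M] [T2Space M] [SecondCountableTopology M]
    [ChartedSpace (EuclideanSpace ℝ (Fin 4)) M] [IsManifold (𝓡 4) ∞ M]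
    (e : M ≃ₕ Metric.sphere (0 : EuclideanSpace ℝ (Fin 5)) 1)
    (hdec : Literature.Topology.FourManifolds.IsConnectedSumOf 4 EuclideanThinPiece M) :
    Nonempty (M ≃ₘ⟮𝓡 4, 𝓡 4⟯ Metric.sphere (0 : EuclideanSpace ℝ (Fin 5)) 1) := by
  haveI : SimplyConnectedSpace M :=
    Literature.Topology.FourManifolds.simplyConnectedSpace_of_homotopyEquiv_sphere_four
      Literature.Topology.FourManifolds.simplyConnectedSpace_sphere_four_holds M e
  refine hdec.nonempty_diffeomorph_sphere_of_simplyConnectedSpace (by norm_num) ?_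
  intro X _ _ hX hsc
  obtain ⟨_, _, _, _, _, ι, hι, hent⟩ := hX
  exact hCMS.2 X hsc ι hι hent

/-- **Flow decomposition** — the analytic content the line must deliver (mean curvature flow in
`N = S⁴×ℝ` below `4/e`: every singular event of the tracked sheets is a neck cut whose excised
piece is Euclidean-certified, and the end-separating sheet relaxes to a slice): every thin
cross-section of the crux's shape is an iterated connected sum of Euclidean-thin pieces. -/
def FlowDecomposition : Prop :=
  ∀ (M : Type) [TopologicalSpace M] [T2Space M] [SecondCountableTopology M]
    [ChartedSpace (EuclideanSpace ℝ (Fin 4)) M] [IsManifold (𝓡 4) ∞ M],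
    M ≃ₕ Metric.sphere (0 : EuclideanSpace ℝ (Fin 5)) 1 →
    ∀ ι : M → EuclideanSpace ℝ (Fin 6), Manifold.IsSmoothEmbedding (𝓡 4) (𝓡 6) ∞ ι →
    (∀ x, ∑ i : Fin 5, ι x (Fin.castSucc i) ^ 2 = 1) →
    (∃ R : ℝ, ∀ a b : EuclideanSpace ℝ (Fin 6), ∑ i : Fin 5, a (Fin.castSucc i) ^ 2 = 1 →
      ∑ i : Fin 5, b (Fin.castSucc i) ^ 2 = 1 → a 5 ≤ -R → R ≤ b 5 →
      ¬ JoinedIn ({z : EuclideanSpace ℝ (Fin 6) | ∑ i : Fin 5, z (Fin.castSucc i) ^ 2 = 1} \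
        Set.range ι) a b) →
    (⨆ (p : EuclideanSpace ℝ (Fin 6)) (_ : ∑ i : Fin 5, p (Fin.castSucc i) ^ 2 = 1) (τ : ℝ)
      (_ : 0 < τ), (μH[4] (Metric.sphere (0 : EuclideanSpace ℝ (Fin 5)) 1))⁻¹ *
        ∫⁻ z in Set.range ι, ENNReal.ofReal ((∑' k : ℕ, Real.exp (-((k : ℝ) * ((k : ℝ) + 3)) * τ) *
          ((2 * (k : ℝ) + 3) / 3) * ∑ l ∈ Finset.range (k / 2 + 1), (-1 : ℝ) ^ l *
          (∏ j ∈ Finset.range (k - l), ((3 : ℝ) / 2 + (j : ℝ))) /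
          (((l.factorial : ℕ) : ℝ) * (((k - 2 * l).factorial : ℕ) : ℝ)) *
          (2 * ∑ i : Fin 5, z (Fin.castSucc i) * p (Fin.castSucc i)) ^ (k - 2 * l)) *
          Real.exp (-((z 5 - p 5) ^ 2) / (4 * τ))) ∂μH[4]) < ENNReal.ofReal (4 / Real.exp 1) →
    Literature.Topology.FourManifolds.IsConnectedSumOf 4 EuclideanThinPiece M

/-- The crux from the flow decomposition and the vendored Euclidean theorem (pure logic). -/
theorem cylinderRungTwo_of_flowDecomposition
    (hCMS : Literature.Geometry.Riemannian.ChodoshMantoulidisSchulze2025_lowEntropy_sphere_four)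
    (hF : FlowDecomposition) :
    Summit.SmoothPoincare4.SmoothPoincare4.Theses.CylinderEntropy.CylinderRungTwo := by
  intro M _ _ _ _ _ e ι hι hN hsep hent
  exact ledger_reduction hCMS M e (hF M e ι hι hN hsep hent)

end Summit.SmoothPoincare4.SmoothPoincare4.Cruxes.CylinderRungTwo.IdeatorK2

end
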